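import Summits.Ventures.PercRepro.C041BlockMapWedge

/-!
# ROW C-041 — TOOLS FOR THEOREM (HANG): the joint vector of a product with a joint vector factorises, `θ_B ∘ θ_R`,
the block map summed in one slot, and the host with an extra exit (p6, gen 34)

Setting of `C041BlockMapMultilinear` / `C041BlockMapWedge`.  THEOREM (HANG) — the block map of a host `K` hung
at a vertex `v` of a host `H` is the block map of `H` with the extra exit `v` evaluated, in the slot `v`, at the
block map of `K` (P6-TWOEXIT-LEAN.md §21) — rests, besides the block bookkeeping of the glued host, on four
algebraic facts proved here: `thR_mul_thR_right` (`θ_R (P · θ_R Q) = θ_R P · θ_R Q`, the joint vector of a product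
with a vector constant on each half factorises; iterated: `thR_mul_prod_thR`), `thB_thR` (`θ_B (θ_R P) = θ_R (θ_B P)
= n(P) · 𝟙`), `thB_exitOf` (`θ_B (exitOf w r) = θ_B w`) with g33's `thB_prod` (C041MultiExitCoincident), and the LINEARITY of the colouring term in
one slot summed over a finite family (`colTerm_update_sum`, from `colTerm_update_add` / `_smul`), which turns the
per-colouring identity into the identity of block maps (`blockMap_update_sum`).  The host with an extra exit:
`uplus v u` (exits `Option ι`, `none ↦ v`) and the inputs `wplus X w` (`X` in the slot `none`), with
`wplus_eq_update`.
-/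

namespace PercRepro

namespace ZoneZ

namespace MultiExit

open ZoneData Pendant Finset TwoExit TreeClosure

/-! ## The joint vector and `θ_B` -/

/-- `θ_R` of a product with a joint vector factorises. -/
theorem thR_mul_thR_right (P Q : Vec6) : thR (P * thR Q) = thR P * thR Q := by
  funext i
  fin_cases i <;> simp [thR, nAdm, kInv] <;> ring

/-- `θ_R` of a product with a finite product of joint vectors factorises. -/
theorem thR_mul_prod_thR {κ : Type} (s : Finset κ) (P : Vec6) (Q : κ → Vec6) :
    thR (P * ∏ B ∈ s, thR (Q B)) = thR P * ∏ B ∈ s, thR (Q B) := by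
  classical
  induction s using Finset.induction_on with
  | empty => simp only [Finset.prod_empty, mul_one]
  | insert B s hBs ih =>
    rw [Finset.prod_insert hBs, ← mul_assoc, mul_right_comm, thR_mul_thR_right, ih, mul_assoc,
      mul_comm (thR (Q B))]

/-- `θ_R 𝟙 = 𝟙`. -/
theorem thR_one : thR (1 : Vec6) = 1 := by
  funext i
  fin_cases i <;> simp [thR, nAdm, kInv]

/-- `θ_B (θ_R P) = θ_R (θ_B P)` (both are `n(P) · 𝟙`). -/
theorem thB_thR (P : Vec6) : thB (thR P) = thR (thB P) := by
  funext i
  fin_cases i <;> simp [thB, thR, nAdm, kInv]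

/-- `θ_B` is idempotent. -/
theorem thB_thB (w : Vec6) : thB (thB w) = thB w := by
  funext i
  fin_cases i <;> rfl

/-- `θ_B` forgets the reach flag. -/
theorem thB_exitOf (w : Vec6) (r : Prop) : thB (exitOf w r) = thB w := by
  unfold exitOf
  by_cases hr : r
  · rw [if_pos hr]
  · rw [if_neg hr, thB_thB]

/-- `θ_R` of a product with a multiple of `𝟙`. -/
theorem thR_mul_smul_one (P : Vec6) (c : ℝ) : thR (P * c • (1 : Vec6)) = c • thR P := by
  funext i
  fin_cases i <;> simp [thR, nAdm, kInv] <;> ring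

/-! ## The host with an extra exit -/

section Extra

variable {ι V₁ : Type} (u : ι → V₁)

/-- The exits `u` with the extra exit `v` in the slot `none`. -/
def uplus (v : V₁) : Option ι → V₁ := fun o => o.elim v u

/-- The inputs with `X` in the slot `none` and `w` elsewhere. -/
def wplus (X : Vec6) (w : ι → Vec6) : Option ι → Vec6 := fun o => o.elim X w

/-- The extra exit. -/
theorem uplus_none (v : V₁) : uplus u v none = v := rfl
/-- An old exit. -/
theorem uplus_some (v : V₁) (k : ι) : uplus u v (some k) = u k := rfl
/-- The extra slot. -/
theorem wplus_none (X : Vec6) (w : ι → Vec6) : wplus X w none = X := rfl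
/-- An old slot. -/
theorem wplus_some (X : Vec6) (w : ι → Vec6) (k : ι) : wplus X w (some k) = w k := rfl

variable [DecidableEq ι]

/-- Changing the extra slot is an update. -/
theorem wplus_eq_update (X Y : Vec6) (w : ι → Vec6) : wplus X w = Function.update (wplus Y w) none X := by
  funext o
  cases o
  · rw [Function.update_self]
    rfl
  · rw [Function.update_of_ne (Option.some_ne_none _)]
    rfl

end Extra

/-! ## The block map summed in one slot -/

variable {ι V₁ E₁ U₁ U₂ : Type} (Z₁ : ZoneData V₁ E₁ U₁ U₂) (u : ι → V₁) (a₁ : V₁)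
variable [Fintype ι] [DecidableEq ι] [Fintype E₁] [DecidableEq E₁]

omit [Fintype E₁] [DecidableEq E₁] in
/-- A colouring term vanishes at a zero slot. -/
theorem colTerm_update_zero (ω : E₁ → Bool) (w : ι → Vec6) (k : ι) :
    colTerm Z₁ u a₁ ω (Function.update w k 0) = 0 := by
  have := colTerm_update_smul Z₁ u a₁ ω w k 0 0
  rwa [zero_smul, zero_smul] at this

omit [Fintype E₁] [DecidableEq E₁] in
/-- A colouring term summed in one slot. -/
theorem colTerm_update_sum {κ : Type} (s : Finset κ) (x : κ → Vec6) (ω : E₁ → Bool) (w : ι → Vec6) (k : ι) :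
    colTerm Z₁ u a₁ ω (Function.update w k (∑ j ∈ s, x j)) = ∑ j ∈ s, colTerm Z₁ u a₁ ω (Function.update w k (x j)) := by
  classical
  induction s using Finset.induction_on with
  | empty => simp only [Finset.sum_empty, colTerm_update_zero]
  | insert j s hjs ih => rw [Finset.sum_insert hjs, Finset.sum_insert hjs, colTerm_update_add, ih]

/-- The block map summed in one slot. -/
theorem blockMap_update_sum {κ : Type} (s : Finset κ) (x : κ → Vec6) (w : ι → Vec6) (k : ι) :
    blockMap Z₁ u a₁ (Function.update w k (∑ j ∈ s, x j)) = ∑ j ∈ s, blockMap Z₁ u a₁ (Function.update w k (x j)) := by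
  classical
  induction s using Finset.induction_on with
  | empty =>
    simp only [Finset.sum_empty]
    have := blockMap_update_smul Z₁ u a₁ w k 0 0
    rwa [zero_smul, zero_smul] at this
  | insert j s hjs ih => rw [Finset.sum_insert hjs, Finset.sum_insert hjs, blockMap_update_add, ih]

/-- **The block map of the host with an extra exit, summed over a family in the extra slot.** -/
theorem blockMap_uplus_sum {κ : Type} (s : Finset κ) (x : κ → Vec6) (v : V₁) (w : ι → Vec6) :
    blockMap Z₁ (uplus u v) a₁ (wplus (∑ j ∈ s, x j) w) = ∑ j ∈ s, blockMap Z₁ (uplus u v) a₁ (wplus (x j) w) := by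
  rw [wplus_eq_update _ 0, blockMap_update_sum]
  exact Finset.sum_congr rfl fun j _ => by rw [← wplus_eq_update]

end MultiExit

end ZoneZ

end PercRepro
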